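import Mathlib
import Summits.Ventures.PercRepro2.Tail2DBlockCalc
import Summits.Ventures.PercRepro2.Tail2DHarrisSP
import Summits.Ventures.PercRepro2.Tail2DFlowOneBlocks
import Summits.Ventures.PercRepro2.Tail2DFlowOnePar
import Summits.Ventures.PercRepro2.Tail2DSDomSwap
import Summits.Ventures.PercRepro2.Tail2DFlowOneStep01
import Summits.Ventures.PercRepro2.Tail2DFlowOneThreeCounts
import Summits.Ventures.PercRepro2.Tail2DParFin
import Summits.Ventures.PercRepro2.Tail2DFlowOneAxis
import Summits.Ventures.PercRepro2.Tail2DAxisClass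
import Summits.Ventures.PercRepro2.Tail2DFourIdent
import Summits.Ventures.PercRepro2.Tail2DRelay20

/-!
# (SD) at `(2,0)` and `(1,1)` on every parallel composition of flow-one factors, arbitrary sizes
(seat mine-b, cell pub-perc-repro2; conjectures/MINE-B.md §45)

The relay step `sdomZ_par_relay_20` needs, of the comb `Y`, (SD) at `(2,0)`, the red axis, and the two count
inequalities `T₁₁ (T₁ + T₂₀) ≥ 2 T₁ T₂₀` and `T₁₁ ≤ 2 T₂₀`.  With `N = #all`, `T₁ = T(1,0)`, `S = T(1,1)`,
`T = T(2,0)` the package `RelayInv N T₁ S T` — the two inequalities with the auxiliary `N T ≤ T₁²`,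
`2 N T ≤ S (N + T₁)` and the trivial `T ≤ S ≤ T₁ ≤ N` — is CLOSED under adding a flow-one factor (the counts
of `X ∥ Y` are `N' = (c + 2a) N`, `T₁' = (a + c) T₁ + a N`, `S' = c S + 2a T₁`, `T' = (a + c) T + a T₁`;
`relayInv_step`), and holds for the empty comb.  Hence, by induction on the number of factors, with the two-factor
theorem `sdomZ_flowOne_par` as the first non-trivial case: **(SD) at `(2,0)` on `X₀ ∥ … ∥ X_{k−1}` for any `k`
flow-one factors with red crossings and ANY sizes** (`sdomZ_parFin_20`), and at `(1,1)` by the colour swap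
(`sdomZ_parFin_11`).  With the top level, the sub-top level, the diagonal and the axes this closes every position
for `k = 4` with arbitrary sizes (`sdomZ_four_all_gen`).
-/

namespace Summit.Ventures.PercRepro2.Tail2D

open V2Closure Finset

section Invariant

/-- the count invariant carried along a comb: `N = #all`, `T₁ = T(1,0)`, `S = T(1,1)`, `T = T(2,0)` -/
def RelayInv (N T1 S T : ℕ) : Prop :=
  S ≤ T1 ∧ T ≤ S ∧ T1 ≤ N ∧ S ≤ 2 * T ∧ N * T ≤ T1 * T1 ∧ 2 * N * T ≤ S * (N + T1) ∧ 2 * T1 * T ≤ S * (T1 + T)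

/-- the invariant of the empty comb (one configuration, no crossing) -/
theorem relayInv_one : RelayInv 1 0 0 0 := by
  unfold RelayInv; omega

/-- **the invariant is closed under adding a flow-one factor** with `a` red crossings and `c` non-crossing
configurations -/
theorem relayInv_step (a c N T1 S T : ℕ) (h : RelayInv N T1 S T) :
    RelayInv ((c + 2 * a) * N) ((a + c) * T1 + a * N) (c * S + 2 * a * T1) ((a + c) * T + a * T1) := by
  obtain ⟨h1, h2, h3, h4, h5, h6, h7⟩ := h
  have hTT1 : T ≤ T1 := le_trans h2 h1
  have hTN : T ≤ N := le_trans hTT1 h3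
  refine ⟨?_, ?_, ?_, ?_, ?_, ?_, ?_⟩
  · nlinarith [Nat.mul_le_mul_left c h1, Nat.mul_le_mul_left a h3]
  · nlinarith [Nat.mul_le_mul_left c h2, Nat.mul_le_mul_left a hTT1]
  · nlinarith [Nat.mul_le_mul_left (a + c) h3]
  · nlinarith [Nat.mul_le_mul_left c h4]
  · nlinarith [Nat.mul_le_mul_left ((a + c) * (a + c)) h5, Nat.mul_le_mul_left (a * N * a) hTN,
      Nat.mul_le_mul_left (a * N * c) hTT1]
  · nlinarith [Nat.mul_le_mul_left (c * (a + c)) h6, Nat.mul_le_mul_left (2 * a * (a + c)) h5,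
      Nat.mul_le_mul_left (2 * a * c * N) h2, Nat.mul_le_mul_left (2 * a * a * N) hTT1]
  · nlinarith [Nat.mul_le_mul_left (c * (a + c)) h7, Nat.mul_le_mul_left (a * c) h6,
      Nat.mul_le_mul_left (2 * a * a) h5]

end Invariant

section CombCounts

variable (X Y : V2Closure.SP)

/-- `#all = c + 2a` on a flow-one network -/
theorem card_conf_flowOne (hX : FlowOne X) : Fintype.card X.Conf = (cellSet X).card + 2 * (rSet X).card := by
  have h1 := card_cellSet_add X hX
  have h2 := card_colSet X hX
  have h3 := card_rSet_le X
  omega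

/-- **the invariant is inherited by `X ∥ Y`** for a flow-one `X` -/
theorem relayInv_par (hX : FlowOne X)
    (h : RelayInv (Fintype.card Y.Conf) (tailCount Y 1 0) (tailCount Y 1 1) (tailCount Y 2 0)) :
    RelayInv (Fintype.card (V2Closure.SP.par X Y).Conf) (tailCount (V2Closure.SP.par X Y) 1 0)
      (tailCount (V2Closure.SP.par X Y) 1 1) (tailCount (V2Closure.SP.par X Y) 2 0) := by
  have hN : Fintype.card (V2Closure.SP.par X Y).Conf = ((cellSet X).card + 2 * (rSet X).card) * Fintype.card Y.Conf := by
    rw [← card_conf_flowOne X hX]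
    exact Fintype.card_prod _ _
  have hcol : Fintype.card X.Conf - (rSet X).card = (rSet X).card + (cellSet X).card := by
    rw [← card_colSet X hX, ← card_cellSet_add X hX]; ring
  have hT1 : tailCount (V2Closure.SP.par X Y) 1 0
      = ((rSet X).card + (cellSet X).card) * tailCount Y 1 0 + (rSet X).card * Fintype.card Y.Conf := by
    rw [tailCount_par_10_left X Y hX, hcol]; ring
  have hS : tailCount (V2Closure.SP.par X Y) 1 1
      = (cellSet X).card * tailCount Y 1 1 + 2 * (rSet X).card * tailCount Y 1 0 := by
    rw [tailCount_par_11_left X Y hX, tailCount_symm Y 0 1]; ring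
  have hT : tailCount (V2Closure.SP.par X Y) 2 0
      = ((rSet X).card + (cellSet X).card) * tailCount Y 2 0 + (rSet X).card * tailCount Y 1 0 := by
    rw [tailCount_par_20_left X Y hX, hcol]; ring
  rw [hN, hT1, hS, hT]
  exact relayInv_step _ _ _ _ _ _ h

/-- the absent edge has no red crossing: `T(a, c) = 0` for `a ≥ 1` -/
theorem tailCount_absent_red (a c : ℕ) (ha : 1 ≤ a) : tailCount V2Closure.SP.absent a c = 0 := by
  rw [tailCount_eq_card, Finset.card_eq_zero, Finset.eq_empty_iff_forall_notMem]
  intro x hx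
  rw [mem_tailSet_iff] at hx
  have : V2Closure.SP.absent.rLab x = 0 := rfl
  omega

/-- **the invariant holds along every comb of flow-one factors** -/
theorem relayInv_parFin : ∀ (k : ℕ) (X : Fin k → V2Closure.SP), (∀ i, FlowOne (X i)) →
    RelayInv (Fintype.card (parFin k X).Conf) (tailCount (parFin k X) 1 0) (tailCount (parFin k X) 1 1)
      (tailCount (parFin k X) 2 0)
  | 0, _, _ => by
      show RelayInv (Fintype.card V2Closure.SP.absent.Conf) (tailCount V2Closure.SP.absent 1 0)
        (tailCount V2Closure.SP.absent 1 1) (tailCount V2Closure.SP.absent 2 0)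
      rw [tailCount_absent_red 1 0 le_rfl, tailCount_absent_red 1 1 le_rfl, tailCount_absent_red 2 0 (by norm_num)]
      have : Fintype.card V2Closure.SP.absent.Conf = 1 := rfl
      rw [this]
      exact relayInv_one
  | k + 1, X, hX => by
      show RelayInv (Fintype.card (V2Closure.SP.par (X 0) (parFin k (Fin.tail X))).Conf) _ _ _
      exact relayInv_par (X 0) (parFin k (Fin.tail X)) (hX 0)
        (relayInv_parFin k (Fin.tail X) (fun i => hX i.succ))

/-- `T(1,0) > 0` on a comb with at least one factor (each with a red crossing) -/
theorem tailCount_parFin_10_pos (k : ℕ) (X : Fin (k + 1) → V2Closure.SP) (hX : ∀ i, FlowOne (X i))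
    (hR : ∀ i, 0 < (rSet (X i)).card) : 0 < tailCount (parFin (k + 1) X) 1 0 := by
  show 0 < tailCount (V2Closure.SP.par (X 0) (parFin k (Fin.tail X))) 1 0
  rw [tailCount_par_10_left (X 0) _ (hX 0)]
  have hN : 0 < Fintype.card (parFin k (Fin.tail X)).Conf := Fintype.card_pos_iff.2 ⟨redConf _⟩
  have := hR 0
  positivity

/-- `T(1,1) > 0` on a comb with at least two factors (each with a red crossing) -/
theorem tailCount_parFin_11_pos (k : ℕ) (X : Fin (k + 2) → V2Closure.SP) (hX : ∀ i, FlowOne (X i))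
    (hR : ∀ i, 0 < (rSet (X i)).card) : 0 < tailCount (parFin (k + 2) X) 1 1 := by
  show 0 < tailCount (V2Closure.SP.par (X 0) (parFin (k + 1) (Fin.tail X))) 1 1
  rw [tailCount_par_11_left (X 0) _ (hX 0)]
  have h1 := tailCount_parFin_10_pos k (Fin.tail X) (fun i => hX i.succ) (fun i => hR i.succ)
  have := hR 0
  positivity

end CombCounts

section Main

/-- `X ∥ absent` is flow-one when `X` is -/
theorem flowOne_par_absent (X : V2Closure.SP) (hX : FlowOne X) : FlowOne (V2Closure.SP.par X V2Closure.SP.absent) := by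
  intro p
  have h := hX p.1
  have e1 : V2Closure.SP.absent.rLab p.2 = 0 := rfl
  have e2 : V2Closure.SP.absent.bLab p.2 = 0 := rfl
  show X.rLab p.1 + V2Closure.SP.absent.rLab p.2 + (X.bLab p.1 + V2Closure.SP.absent.bLab p.2) ≤ 1
  omega

/-- **(SD) at `(2,0)` on every parallel composition of flow-one factors with red crossings, any sizes** -/
theorem sdomZ_parFin_20 : ∀ (k : ℕ) (X : Fin k → V2Closure.SP), (∀ i, FlowOne (X i)) →
    (∀ i, 0 < (rSet (X i)).card) → SDomZ (parFin k X) 2 0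
  | 0, _, _, _ => sdomZ_absent 2 0
  | 1, X, hX, _ => by
      apply sdomZ_of_tailCount_zero
      left
      exact tailCount_parFin_eq_zero 1 X hX 2 0 (by norm_num)
  | 2, X, hX, hR => by
      show SDomZ (V2Closure.SP.par (X 0) (parFin 1 (Fin.tail X))) 2 0
      have h1 : FlowOne (parFin 1 (Fin.tail X)) := flowOne_par_absent _ (hX 1)
      have h2 : 0 < (rSet (parFin 1 (Fin.tail X))).card := tailCount_parFin_10_pos 0 (Fin.tail X)
        (fun i => hX i.succ) (fun i => hR i.succ)
      exact sdomZ_flowOne_par (X 0) _ (hX 0) h1 (hR 0) h2 2 0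
  | k + 3, X, hX, hR => by
      show SDomZ (V2Closure.SP.par (X 0) (parFin (k + 2) (Fin.tail X))) 2 0
      have ih := sdomZ_parFin_20 (k + 2) (Fin.tail X) (fun i => hX i.succ) (fun i => hR i.succ)
      obtain ⟨-, h2, -, h4, -, -, h7⟩ := relayInv_parFin (k + 2) (Fin.tail X) (fun i => hX i.succ)
      have hax := sdomZ_axisComb_red (axisComb_parFin (k + 2) (Fin.tail X) (fun i => ⟨hX i.succ, hR i.succ⟩)) 1
      norm_num at hax
      have hS := tailCount_parFin_11_pos k (Fin.tail X) (fun i => hX i.succ) (fun i => hR i.succ)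
      exact sdomZ_par_relay_20 (X 0) _ (hX 0) (hR 0) ih hax hS h2 h4 h7

/-- **(SD) at `(1,1)` on every parallel composition of flow-one factors with red crossings**, by the colour swap -/
theorem sdomZ_parFin_11 (k : ℕ) (X : Fin k → V2Closure.SP) (hX : ∀ i, FlowOne (X i))
    (hR : ∀ i, 0 < (rSet (X i)).card) : SDomZ (parFin k X) 1 1 := by
  have h := sdomZ_parFin_20 k X hX hR
  rw [sdomZ_swap_iff] at h
  norm_num at h
  exact h

/-- **(SD) at EVERY clipped position on `X₀ ∥ X₁ ∥ X₂ ∥ X₃` for any four flow-one factors with red crossings and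
ARBITRARY sizes**: the axes by the axis class, the empty tails, Harris at `u ≤ 1, v ≤ 0`, the top level, the sub-top
level, the diagonal, and `(2,0)` / `(1,1)` by the relay -/
theorem sdomZ_four_all_gen (X : Fin 4 → V2Closure.SP) (hX : ∀ i, FlowOne (X i)) (hR : ∀ i, 0 < (rSet (X i)).card)
    (u v : ℤ) : SDomZ (parFin 4 X) u v := by
  by_cases haxis : u ≤ 0 ∨ v ≤ -1
  · exact sdomZ_axisComb_axis (axisComb_parFin 4 X (fun i => ⟨hX i, hR i⟩)) u v haxis
  push Not at haxis
  obtain ⟨u', rfl⟩ : ∃ u' : ℕ, u = u' := ⟨u.toNat, by omega⟩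
  obtain ⟨v', rfl⟩ : ∃ v' : ℕ, v = v' := ⟨v.toNat, by omega⟩
  have hu : 1 ≤ u' := by omega
  by_cases hbig : 4 < u' + v'
  · apply sdomZ_of_tailCount_zero
    left
    rw [show ((u' : ℤ)).toNat = u' by omega, show ((v' : ℤ)).toNat = v' by omega]
    exact tailCount_parFin_eq_zero 4 X hX u' v' hbig
  push Not at hbig
  rcases (show u' + v' = 4 ∨ u' + v' = 3 ∨ u' = v' + 1 ∨ (u' = 2 ∧ v' = 0) ∨ (u' = 1 ∧ v' = 1) ∨ (u' = 1 ∧ v' = 0)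
      by omega) with h | h | h | ⟨h1, h2⟩ | ⟨h1, h2⟩ | ⟨h1, h2⟩
  · have := sdomZ_parFin_top 4 X u' hX hu (by omega)
    rwa [show 4 - u' = v' by omega] at this
  · exact sdomZ_parFin_subtop_all 4 X u' v' hX hR (by omega) hu
  · subst h
    have := sdomZ_parFin_diag 4 X (v' + 1) hX (by omega)
    push_cast at this
    simpa using this
  · subst h1; subst h2; exact sdomZ_parFin_20 4 X hX hR
  · subst h1; subst h2; exact sdomZ_parFin_11 4 X hX hR
  · subst h1; subst h2; exact sdomZ_of_le_one _ _ _ (by norm_num) (by norm_num)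

end Main

end Summit.Ventures.PercRepro2.Tail2D
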